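import Summits.BirchSwinnertonDyer.BirchSwinnertonDyer.Theorems.PrintCf2SplitBadTwoCMPrimaryDyadicValue
import Summits.BirchSwinnertonDyer.BirchSwinnertonDyer.Theorems.PrintCf2SplitBadTwoLocalControlKernelDecomp
import Summits.BirchSwinnertonDyer.BirchSwinnertonDyer.Theorems.PrintCf2SplitBadTwoCMPrimaryPinningSwap
import Summits.BirchSwinnertonDyer.BirchSwinnertonDyer.Theorems.PrintCf2SplitBadTwoReductionTypesOverK
import Summits.BirchSwinnertonDyer.BirchSwinnertonDyer.Theorems.GenusKolyvaginAtTwoGenusPrimitiveSupplyAtTwoTwistRamifiedTransversal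
import Literature.NumberTheory.GaloisRepresentations.DecompositionFieldRigidity
import HarnessLib

/-!
# Crux `PrintCf2.SplitBadTwoRankOneOfFacts` (stmt-BirchSwinnertonDyer-20368), road α v10.2 — brick B15 file 4: the EXACT DYADIC VALUE ON THE FRAME —
# `#W*(K_{v̄}) = 2` for every member with `d ≢ 3 (mod 8)`, hence `#LK_{v̄} ≤ 2` there (every `κ'`)

Cell `bsd-print-cf2`, width seat `bsd-line-cf2-p1-w2` g9 (prover-bsd-line-cf2-p1-w2-g9-0); brick B15 (memo
`Cruxes/SplitBadTwoRankOneOfFacts/B15-DYADIC-EXACT-w2g9.md` §3); `--supports stmt-BirchSwinnertonDyer-20368` (helper, Theses-free). HONEST FRAMING: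
nothing here closes the crux or a registered stub; BSD is not proved by any of this; no summit statement is proved by this seat. No definition, no named
fact, no `sorry`. Sequel of file 3 (`…CMPrimaryDyadicValue`: the mover of `C'[4]` from a test element of prescribed parity on `√(−d)`).

WHAT. The S3c₂ frame: `C • W = cm7^{(d)}` (`d ≠ 0` squarefree, `d ≢ 1 (4)`), `K` imaginary quadratic, `v̄ ≠ v` the places above `2`, `π² = π − 2` in `End_K(E_K)`,
`r² = r − 2`, and the PINNING clause at `v` for `W* := E[𝔮_r^∞]` — so `W*` is of KERNEL type at `v̄` (p654457 swap + p657782 `…_localTypes_named_of_pinned`).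
* §1 `smul_geomSqrt_mul_geomSqrt_neg_one` (signs multiply on `ι√d · ι√(−1)`), `geomSqrt_mul_geomSqrt_neg_one_sq` (`(ι√d·ζ₄)² = −d`), `sign_mul_eq_of_smul_geomSqrt`
  (the parity `s·e` of `g` on `√(−d)` is read off `g • √(−d) = ±√(−d)`); `exists_sq_eq_adicCompletion_of_emod_eight` — HENSEL: an integer `m ≡ 1 (8)` is a
  square in `K_w` at every `w ∣ 2` of every number field (`X² − X − 2c`, `m = 8c + 1`, has the simple root `0` mod `𝔪_w`; tree `adicCompletionIntegers.henselianLocalRing`).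
* §2 THE TEST ELEMENTS: `d` even — a dyadic Kummer inertia element of `Γ_{K_{v̄}}` negating `√(−d)` (`ord_{v̄}(−d) = 1` as `e(v̄|2) = 1`,
  `…GenusKolyTwistRamified.exists_mem_absInertia_smul_geomSqrt_eq_neg`), degree `0`, parity `−1`; `d ≡ 7 (8)` — any element of degree `1` (`exists_isFrobPow_holds`),
  which FIXES `√(−d) ∈ K_{v̄}` (§1 Hensel + `absGaloisRestrict_smul_eq_of_mem_range`), parity `+1 = (−1)²`. Hence
  **`exists_mem_decomp_vbar_smul_ne_of_frame`** (`d ≢ 3 (8)`: some `δ ∈ D_{v̄}` moves a point of `W*[4]`), **`natCard_fixedPoints_decomp_vbar_eq_two_of_frame`**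
  (`#W*(K_{v̄}) = #H⁰(K_{v̄}, W*) = 2` EXACTLY — the dyadic value of Agboola §6 / Prop. 8.1 for these classes) and, with -w3's
  `finite_localControlKer_and_card_le_fixedPoints_decomp` (p659525, layer-`0` currency), **`natCard_localControlKer_vbar_le_two_of_frame`**: `#LK_{v̄} ≤ 2`
  for EVERY `ℤ₂`-line `κ'` when `d ≢ 3 (8)` (the CFT-free half of the memo's table; for `d ≡ 3 (8)` the value `#W*(K_{v̄}) = 4` and the true `LK_{v̄} = 0`
  need the unramified character / the CFT shape of `ker κ'`, not claimed).
presearch: Rubin LNM 1716 §3 Lemma 3.6 (ii), Cor. 3.17; Agboola 2007 §6, Prop. 8.1; Serre *Cours d'arithmétique* II §3.3 (squares in `ℚ₂`), Neukirch II (4.6)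
— held; tree: `exists_sq_eq_adicCompletion_of_mod_eight` is the `K = ℚ` case via `ℚ_v ≃ ℚ₂` (p65xxxx GenusKoly), here any number field by Hensel. beyond-print
theorem: no.

References: [Rubin1999] §3 Lemma 3.6 (ii), Cor. 3.17; [Agboola2007] §6, Prop. 8.1; [Serre1973] Ch. II §3.3; [NeukirchANT1999] Ch. II (4.6), (9.6).
-/

noncomputable section

open scoped Classical Valued

set_option linter.dupNamespace false
set_option autoImplicit false

namespace Summit.BirchSwinnertonDyer.BirchSwinnertonDyer.Theorems.PrintCf2.CMPrimes

open WeierstrassCurve Literature.NumberTheory.EllipticCurves Literature.NumberTheory.GaloisRepresentations Field NumberField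
  IsDedekindDomain Polynomial
open Rat.HeightOneSpectrum
open Summit.BirchSwinnertonDyer.BirchSwinnertonDyer.Theorems.PrintCf2.AdditiveAtSeven
open Summit.BirchSwinnertonDyer.BirchSwinnertonDyer.Theorems.PrintCf2.ReductionTypesOverK
open Summit.BirchSwinnertonDyer.BirchSwinnertonDyer.Theorems.PrintCf2.RestrictedSelmerPair
open Summit.BirchSwinnertonDyer.BirchSwinnertonDyer.Theorems.GenusKolyTwistRamified (exists_mem_absInertia_smul_geomSqrt_eq_neg)

/-! ## §1. Signs on `√d·ζ₄ = ±√(−d)`; squares `≡ 1 (mod 8)` in `K_w`, `w ∣ 2` -/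

section Signs

variable (K : Type) [Field K] [NumberField K]

/-- Signs multiply: if `g` acts on `A = ι√d` by `s` and on `Z = ι√(−1)` by `e`, it acts on `A·Z` by `s·e`. [folklore] -/
theorem smul_geomSqrt_mul_geomSqrt_neg_one (d : ℚ) (g : absoluteGaloisGroup K) {s e : ℤ}
    (hs : (g • absClosureEmbedding ℚ K (WeierstrassCurve.geomSqrt d) = absClosureEmbedding ℚ K (WeierstrassCurve.geomSqrt d) ∧ s = 1) ∨
      (g • absClosureEmbedding ℚ K (WeierstrassCurve.geomSqrt d) = -absClosureEmbedding ℚ K (WeierstrassCurve.geomSqrt d) ∧ s = -1))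
    (he : (g • absClosureEmbedding ℚ K (WeierstrassCurve.geomSqrt (-1 : ℚ)) = absClosureEmbedding ℚ K (WeierstrassCurve.geomSqrt (-1 : ℚ)) ∧ e = 1) ∨
      (g • absClosureEmbedding ℚ K (WeierstrassCurve.geomSqrt (-1 : ℚ)) = -absClosureEmbedding ℚ K (WeierstrassCurve.geomSqrt (-1 : ℚ)) ∧ e = -1)) :
    g • (absClosureEmbedding ℚ K (WeierstrassCurve.geomSqrt d) * absClosureEmbedding ℚ K (WeierstrassCurve.geomSqrt (-1 : ℚ))) =
      ((s * e : ℤ) : AlgebraicClosure K) *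
        (absClosureEmbedding ℚ K (WeierstrassCurve.geomSqrt d) * absClosureEmbedding ℚ K (WeierstrassCurve.geomSqrt (-1 : ℚ))) := by
  rcases hs with ⟨hA, rfl⟩ | ⟨hA, rfl⟩ <;> rcases he with ⟨hZ, rfl⟩ | ⟨hZ, rfl⟩ <;>
    · rw [smul_mul', hA, hZ]; push_cast; ring

/-- `(ι√d · ι√(−1))² = −d` in `K̄` (as the image of `−d ∈ K`). [folklore] -/
theorem geomSqrt_mul_geomSqrt_neg_one_sq (d : ℤ) :
    (absClosureEmbedding ℚ K (WeierstrassCurve.geomSqrt (d : ℚ)) * absClosureEmbedding ℚ K (WeierstrassCurve.geomSqrt (-1 : ℚ))) ^ 2 =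
      algebraMap K (AlgebraicClosure K) ((-d : ℤ) : K) := by
  rw [mul_pow, ← map_pow, ← map_pow, WeierstrassCurve.geomSqrt_sq, WeierstrassCurve.geomSqrt_sq, AlgHom.commutes, AlgHom.commutes]
  simp only [map_neg, map_one, map_intCast, Int.cast_neg, mul_neg_one]

/-- **The parity of `g` on `√(−d)` is `s·e`**: if `g` acts on `ι√d` by `s`, on `ζ₄ = ι√(−1)` by `e`, and on `√(−d) ∈ K̄` (the square root of `−d ∈ K`)
by the sign `u`, then `s·e = u`. [folklore] -/
theorem sign_mul_eq_of_smul_geomSqrt {d : ℤ} (hd : d ≠ 0) (g : absoluteGaloisGroup K) {s e u : ℤ}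
    (hs : (g • absClosureEmbedding ℚ K (WeierstrassCurve.geomSqrt (d : ℚ)) = absClosureEmbedding ℚ K (WeierstrassCurve.geomSqrt (d : ℚ)) ∧ s = 1) ∨
      (g • absClosureEmbedding ℚ K (WeierstrassCurve.geomSqrt (d : ℚ)) = -absClosureEmbedding ℚ K (WeierstrassCurve.geomSqrt (d : ℚ)) ∧ s = -1))
    (he : (g • absClosureEmbedding ℚ K (WeierstrassCurve.geomSqrt (-1 : ℚ)) = absClosureEmbedding ℚ K (WeierstrassCurve.geomSqrt (-1 : ℚ)) ∧ e = 1) ∨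
      (g • absClosureEmbedding ℚ K (WeierstrassCurve.geomSqrt (-1 : ℚ)) = -absClosureEmbedding ℚ K (WeierstrassCurve.geomSqrt (-1 : ℚ)) ∧ e = -1))
    (hu : (g • WeierstrassCurve.geomSqrt ((-d : ℤ) : K) = WeierstrassCurve.geomSqrt ((-d : ℤ) : K) ∧ u = 1) ∨
      (g • WeierstrassCurve.geomSqrt ((-d : ℤ) : K) = -WeierstrassCurve.geomSqrt ((-d : ℤ) : K) ∧ u = -1)) :
    s * e = u := by
  set A := absClosureEmbedding ℚ K (WeierstrassCurve.geomSqrt (d : ℚ)) with hA_def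
  set Z := absClosureEmbedding ℚ K (WeierstrassCurve.geomSqrt (-1 : ℚ)) with hZ_def
  set B := WeierstrassCurve.geomSqrt ((-d : ℤ) : K) with hB_def
  have hB0 : B ≠ 0 := WeierstrassCurve.geomSqrt_ne_zero (by exact_mod_cast (neg_ne_zero.mpr hd))
  have hsq : (A * Z) ^ 2 = B ^ 2 := by
    rw [geomSqrt_mul_geomSqrt_neg_one_sq, hB_def, WeierstrassCurve.geomSqrt_sq]
  have hAZ := smul_geomSqrt_mul_geomSqrt_neg_one K (d : ℚ) g hs he
  -- `g • B = (s e) B`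
  have hgB : g • B = ((s * e : ℤ) : AlgebraicClosure K) * B := by
    rcases sq_eq_sq_iff_eq_or_eq_neg.mp hsq with h | h
    · rw [← h]; exact hAZ
    · have h' : B = -(A * Z) := by rw [h, neg_neg]
      rw [h', smul_neg, hAZ, mul_neg]
  -- compare with the sign `u`
  have hse1 : s * e = 1 ∨ s * e = -1 := by
    rcases hs with ⟨-, rfl⟩ | ⟨-, rfl⟩ <;> rcases he with ⟨-, rfl⟩ | ⟨-, rfl⟩ <;> simp
  have h2 : (2 : AlgebraicClosure K) ≠ 0 := two_ne_zero
  rcases hu with ⟨hB, rfl⟩ | ⟨hB, rfl⟩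
  · rcases hse1 with h1 | h1
    · exact h1
    · exfalso
      rw [hB, h1] at hgB
      push_cast at hgB
      exact hB0 (by linear_combination hgB / 2)
  · rcases hse1 with h1 | h1
    · exfalso
      rw [hB, h1] at hgB
      push_cast at hgB
      exact hB0 (by linear_combination -hgB / 2)
    · exact h1

omit [NumberField K] in
/-- **Hensel at `2`: an integer `m ≡ 1 (mod 8)` is a square in `K_w` for every place `w ∣ 2` of a number field** — the monic `X² − X − 2c` (`m = 8c + 1`)
has the simple root `0` modulo `𝔪_w` (its derivative there is `−1`), so it has a root `a ∈ O_w` (tree `adicCompletionIntegers.henselianLocalRing`), and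
`(2a − 1)² = 4(a² − a) + 1 = 8c + 1 = m`. [cite: NeukirchANT1999, Ch. II §4 Lemma (4.6)] [cite: Serre1973, Ch. II §3.3 Thm. 4] -/
theorem exists_sq_eq_adicCompletion_of_emod_eight [NumberField K] (w : HeightOneSpectrum (𝓞 K)) (h2 : ((2 : ℕ) : 𝓞 K) ∈ w.asIdeal)
    {m : ℤ} (hm : m % 8 = 1) :
    ∃ s : w.adicCompletion K, s ^ 2 = algebraMap K (w.adicCompletion K) (m : K) := by
  set R := w.adicCompletionIntegers K with hR_def
  obtain ⟨c, hc⟩ : ∃ c : ℤ, m = 8 * c + 1 := ⟨(m - 1) / 8, by omega⟩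
  -- `2 ∈ 𝔪_w`
  have h2m : (2 : R) ∈ IsLocalRing.maximalIdeal R := by
    rw [mem_maximalIdeal_adicCompletionIntegers_iff, Valued.toNormedField.norm_lt_one_iff]
    have h2R : (((2 : R) : w.adicCompletion K)) = (2 : w.adicCompletion K) := by norm_cast
    have h2K : ((2 : K) : w.adicCompletion K) = (2 : w.adicCompletion K) := map_ofNat (algebraMap K (w.adicCompletion K)) 2
    rw [h2R, ← h2K, HeightOneSpectrum.valuedAdicCompletion_eq_valuation',
      show (2 : K) = algebraMap (𝓞 K) K ((2 : ℕ) : 𝓞 K) by push_cast; rfl, HeightOneSpectrum.valuation_of_algebraMap]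
    exact (HeightOneSpectrum.intValuation_lt_one_iff_mem _ _).mpr h2
  let f : R[X] := X ^ 2 - (X + C ((2 * c : ℤ) : R))
  have hmonic : f.Monic := by
    refine (monic_X_pow 2).sub_of_left (lt_of_le_of_lt (degree_add_le _ _) ?_)
    rw [degree_X_pow]
    refine max_lt ?_ (lt_of_le_of_lt degree_C_le ?_)
    · rw [degree_X]; exact_mod_cast Nat.one_lt_two
    · exact_mod_cast Nat.zero_lt_two
  have h₁ : f.eval 0 ∈ IsLocalRing.maximalIdeal R := by
    have he : f.eval 0 = -(2 * (c : R)) := by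
      simp only [f, eval_sub, eval_pow, eval_X, eval_add, eval_C]
      push_cast; ring
    rw [he]
    exact neg_mem (Ideal.mul_mem_right _ _ h2m)
  have h₂ : IsUnit (f.derivative.eval 0) := by
    have he : f.derivative.eval 0 = -1 := by
      simp only [f, derivative_sub, derivative_X_pow, derivative_add, derivative_X, derivative_C, eval_sub, eval_mul,
        eval_pow, eval_X, eval_C, eval_one, add_zero]
      push_cast; ring
    rw [he]; exact isUnit_one.neg
  obtain ⟨a, ha, -⟩ := HenselianLocalRing.is_henselian f hmonic 0 h₁ h₂
  have ha' : a ^ 2 = a + ((2 * c : ℤ) : R) := by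
    have h := ha.eq_zero
    simp only [f, eval_sub, eval_pow, eval_X, eval_add, eval_C] at h
    exact sub_eq_zero.mp h
  refine ⟨((2 * a - 1 : R) : w.adicCompletion K), ?_⟩
  have hsq : (2 * a - 1 : R) ^ 2 = ((m : ℤ) : R) := by
    rw [hc]; push_cast at ha' ⊢
    linear_combination (4 : R) * ha'
  have h := congrArg (Subtype.val : R → w.adicCompletion K) hsq
  push_cast at h ⊢
  rw [h, map_intCast]

end Signs

/-! ## §2. The frame: test elements at `v̄`, the exact dyadic value, and `#LK_{v̄} ≤ 2` for `d ≢ 3 (8)` -/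

section Frame

variable {K : Type} [Field K] [NumberField K]

/-- **ON THE S3c₂ FRAME WITH `d ≢ 3 (mod 8)`, SOME `δ ∈ D_{v̄}` MOVES A POINT OF `W*[4]`** (`W* = E[𝔮_r^∞]` pinned at `v`, kernel type at `v̄`): for `d` even a
dyadic Kummer inertia element negating `√(−d)` (degree `0`, parity `−1`), for `d ≡ 7 (8)` a degree-`1` element (it fixes `√(−d) ∈ K_{v̄}`, parity `+1`) —
both are movers by file 3 `exists_mem_decomp_smul_ne_of_kernelType`. [cite: Rubin1999, §3 Lemma 3.6 (ii) and Cor. 3.17] [cite: Agboola2007, §6 and Prop. 8.1] -/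
theorem exists_mem_decomp_vbar_smul_ne_of_frame {d : ℤ} (hd0 : d ≠ 0) (hsq : Squarefree d) (hd4 : d % 4 ≠ 1) (hd8 : d % 8 ≠ 3)
    (W : WeierstrassCurve ℚ) [W.IsElliptic] (C : VariableChange ℚ) (hC : C • W = cm7.quadraticTwist (d : ℚ)) (hK : IsImaginaryQuadratic K)
    (v vbar : HeightOneSpectrum (𝓞 K)) (hv : ((2 : ℕ) : 𝓞 K) ∈ v.asIdeal) (hvbar : ((2 : ℕ) : 𝓞 K) ∈ vbar.asIdeal) (hne : vbar ≠ v)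
    (π : (W.baseChange K).endRing) (hrel : (π : AddMonoid.End (W.baseChange K).geomPoints) * π = π - 2) {r : ℤ_[2]} (hr : r * r = r - 2)
    (hclause : ∀ τ ∈ GreenbergSelmer.inertia v, ∀ x : ↥((W.baseChange K).endEigenPrimaryTorsion 2 π r), τ • x = x ∨ τ • x = -x) :
    ∃ δ ∈ GreenbergSelmer.decomp vbar, ∃ x ∈ (W.baseChange K).endEigenPrimaryTorsion 2 π r, 4 • x = 0 ∧ δ • x ≠ x := by
  haveI : Fact (Nat.Prime 2) := ⟨Nat.prime_two⟩
  have hj : W.j = -3375 := j_eq_of_smul_eq_cm7Twist hd0 W C hC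
  obtain ⟨θ, hθ⟩ := exists_sq_eq_neg_seven_of_cmEndo_mem_endRing W K hj π hrel
  have hK2 : Module.finrank ℚ K = 2 := hK.1
  -- the kernel-type clause (R) at `v̄` for `E[𝔮_r^∞]`
  obtain ⟨hcl', -⟩ := endEigenPrimaryTorsion_two_pinningClause_swap W K hj hK hθ π hrel hr hv hvbar hne hclause
  have hcl'' : ∀ τ ∈ GreenbergSelmer.inertia vbar, ∀ x ∈ (W.baseChange K).endEigenPrimaryTorsion 2 π (1 - r),
      τ • x = x ∨ τ • x = -x := fun τ hτ x hx ↦ by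
    rcases hcl' τ hτ ⟨x, hx⟩ with h | h
    · exact Or.inl (congrArg Subtype.val h)
    · exact Or.inr (congrArg Subtype.val h)
  have h1r : (1 - r) * (1 - r) = (1 - r) - 2 := by linear_combination hr
  have hdQ : (d : ℚ) ≠ 0 := by exact_mod_cast hd0
  obtain ⟨α, hα, -, hUR⟩ := endEigenPrimaryTorsion_two_localTypes_named_of_pinned W K hj hθ π hrel h1r hdQ C hC vbar hvbar
    (inertiaDeg_eq_one_of_ne_two K hK2 hvbar hv hne.symm) hcl''
  simp only [sub_sub_cancel] at hUR
  have HR := fun σ n hσ s hs ↦ (hUR σ n hσ s hs).2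
  by_cases h2d : 2 ∣ d
  · -- `d` even: a Kummer inertia element negating `√(−d)`
    obtain ⟨d', rfl⟩ := h2d
    have hd' : ¬ (2 : ℤ) ∣ d' := by
      rintro ⟨k, rfl⟩
      have h := hsq 2 ⟨k, by ring⟩
      rw [Int.isUnit_iff] at h; omega
    -- `ord_{v̄}(−d) = 1`
    set u := vbar.under (𝓞 ℚ) with hu
    have h2u : ((2 : ℕ) : 𝓞 ℚ) ∈ u.asIdeal := by
      change algebraMap (𝓞 ℚ) (𝓞 K) ((2 : ℕ) : 𝓞 ℚ) ∈ vbar.asIdeal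
      rwa [map_natCast]
    have hgen : natGenerator u = 2 :=
      (Nat.prime_dvd_prime_iff_eq (prime_natGenerator u) Nat.prime_two).mp ((Rat.natCast_mem_asIdeal_iff _).mp h2u)
    have he1 : vbar.asIdeal.ramificationIdx (𝓞 ℚ) = 1 :=
      ramificationIdx_eq_one_of_frame K vbar hK hθ hd0 W hC (by rw [← hu, hgen]; norm_num)
    have hval : vbar.valuation K ((-(2 * d') : ℤ) : K) = WithZero.exp (-1 : ℤ) := by
      have hnd : ¬ ((natGenerator u : ℕ) : ℤ) ∣ (-d') := by rw [hgen]; exact fun h ↦ hd' (dvd_neg.mp h)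
      have h := Rat.valuation_pow_mul_intCast u hnd 1
      rw [hgen, pow_one] at h
      rw [show ((-(2 * d') : ℤ) : K) = algebraMap ℚ K ((((2 : ℕ) : ℚ) * ((-d' : ℤ) : ℚ))) by
          rw [map_mul, map_natCast, map_intCast]; push_cast; ring,
        valuation_algebraMap_eq_pow_ramificationIdx K vbar, he1, pow_one, ← hu]
      exact_mod_cast h
    obtain ⟨τ, hτI, hτB⟩ := exists_mem_absInertia_smul_geomSqrt_eq_neg (K := K) vbar (d := ((-(2 * d') : ℤ) : K))
      (by exact_mod_cast (show (-(2 * d') : ℤ) ≠ 0 by omega)) ⟨_, 1, hval, by ring⟩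
    have hτ0 : IsFrobPow τ ((0 : ℕ) : ℤ) := by exact_mod_cast isFrobPow_zero_iff_mem_absInertia.mpr hτI
    set g := absGaloisRestrict K (vbar.adicCompletion K) τ with hg
    rcases smul_absClosureEmbedding_geomSqrt_eq_or K ((2 * d' : ℤ) : ℚ) g with hA | hA <;>
      rcases smul_absClosureEmbedding_geomSqrt_eq_or K (-1 : ℚ) g with hZ | hZ
    · have hse := sign_mul_eq_of_smul_geomSqrt K (d := 2 * d') hd0 g (s := 1) (e := 1) (Or.inl ⟨hA, rfl⟩) (Or.inl ⟨hZ, rfl⟩)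
        (Or.inr ⟨hτB, rfl⟩)
      norm_num at hse
    · exact exists_mem_decomp_smul_ne_of_kernelType K W hj hθ π hrel hr hα HR hτ0 (s := 1) (e := -1)
        (Or.inl ⟨hA, rfl⟩) (Or.inr ⟨hZ, rfl⟩) (by norm_num)
    · exact exists_mem_decomp_smul_ne_of_kernelType K W hj hθ π hrel hr hα HR hτ0 (s := -1) (e := 1)
        (Or.inr ⟨hA, rfl⟩) (Or.inl ⟨hZ, rfl⟩) (by norm_num)
    · have hse := sign_mul_eq_of_smul_geomSqrt K (d := 2 * d') hd0 g (s := -1) (e := -1) (Or.inr ⟨hA, rfl⟩) (Or.inr ⟨hZ, rfl⟩)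
        (Or.inr ⟨hτB, rfl⟩)
      norm_num at hse
  · -- `d ≡ 7 (mod 8)`: a degree-one element, fixing `√(−d) ∈ K_{v̄}`
    have hd7 : (-d) % 8 = 1 := by omega
    obtain ⟨sK, hsK⟩ := exists_sq_eq_adicCompletion_of_emod_eight K vbar hvbar hd7
    set B := WeierstrassCurve.geomSqrt ((-d : ℤ) : K) with hB_def
    have hBfix : ∀ σ : absoluteGaloisGroup (vbar.adicCompletion K), absGaloisRestrict K (vbar.adicCompletion K) σ • B = B := by
      intro σ
      refine absGaloisRestrict_smul_eq_of_mem_range K vbar σ ?_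
      set ι := absClosureEmbedding K (vbar.adicCompletion K) with hι
      have hιB : (ι B) ^ 2 = (algebraMap (vbar.adicCompletion K) (AlgebraicClosure (vbar.adicCompletion K)) sK) ^ 2 := by
        rw [← map_pow, hB_def, WeierstrassCurve.geomSqrt_sq, AlgHom.commutes, ← map_pow, hsK,
          ← IsScalarTower.algebraMap_apply K (vbar.adicCompletion K) (AlgebraicClosure (vbar.adicCompletion K))]
      rcases sq_eq_sq_iff_eq_or_eq_neg.mp hιB with h | h
      · exact ⟨sK, h.symm⟩
      · exact ⟨-sK, by rw [map_neg, h]⟩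
    obtain ⟨σ₁, hσ₁⟩ := exists_isFrobPow_holds (F := vbar.adicCompletion K) 1
    have hσ₁' : IsFrobPow σ₁ ((1 : ℕ) : ℤ) := by exact_mod_cast hσ₁
    set g := absGaloisRestrict K (vbar.adicCompletion K) σ₁ with hg
    rcases smul_absClosureEmbedding_geomSqrt_eq_or K (d : ℚ) g with hA | hA <;>
      rcases smul_absClosureEmbedding_geomSqrt_eq_or K (-1 : ℚ) g with hZ | hZ
    · exact exists_mem_decomp_smul_ne_of_kernelType K W hj hθ π hrel hr hα HR hσ₁' (s := 1) (e := 1)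
        (Or.inl ⟨hA, rfl⟩) (Or.inl ⟨hZ, rfl⟩) (by norm_num)
    · have hse := sign_mul_eq_of_smul_geomSqrt K hd0 g (s := 1) (e := -1) (Or.inl ⟨hA, rfl⟩) (Or.inr ⟨hZ, rfl⟩)
        (Or.inl ⟨hBfix σ₁, rfl⟩)
      norm_num at hse
    · have hse := sign_mul_eq_of_smul_geomSqrt K hd0 g (s := -1) (e := 1) (Or.inr ⟨hA, rfl⟩) (Or.inl ⟨hZ, rfl⟩)
        (Or.inl ⟨hBfix σ₁, rfl⟩)
      norm_num at hse
    · exact exists_mem_decomp_smul_ne_of_kernelType K W hj hθ π hrel hr hα HR hσ₁' (s := -1) (e := -1)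
        (Or.inr ⟨hA, rfl⟩) (Or.inr ⟨hZ, rfl⟩) (by norm_num)

/-- **THE EXACT DYADIC VALUE `#W*(K_{v̄}) = 2` FOR `d ≢ 3 (mod 8)`** on every S3c₂ frame (member `C • W = cm7^{(d)}`, `d ≠ 0` squarefree, `d ≢ 1 (4)`, `K` imaginary
quadratic, `v̄ ≠ v` above `2`, `π² = π − 2` in `End_K(E_K)`, `r² = r − 2`, pinning clause at `v`): `#H⁰(K_{v̄}, E[𝔮_r^∞]) = 2` — the `D_{v̄}`-fixed subgroup of `W*` is
`W*[2]` (a mover exists; file 3 `natCard_fixedPoints_decomp_eq_two_of_exists_smul_ne`). [cite: Agboola2007, §6 and Prop. 8.1] [cite: Rubin1999, §3 Cor. 3.17] -/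
theorem natCard_fixedPoints_decomp_vbar_eq_two_of_frame {d : ℤ} (hd0 : d ≠ 0) (hsq : Squarefree d) (hd4 : d % 4 ≠ 1) (hd8 : d % 8 ≠ 3)
    (W : WeierstrassCurve ℚ) [W.IsElliptic] (C : VariableChange ℚ) (hC : C • W = cm7.quadraticTwist (d : ℚ)) (hK : IsImaginaryQuadratic K)
    (v vbar : HeightOneSpectrum (𝓞 K)) (hv : ((2 : ℕ) : 𝓞 K) ∈ v.asIdeal) (hvbar : ((2 : ℕ) : 𝓞 K) ∈ vbar.asIdeal) (hne : vbar ≠ v)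
    (π : (W.baseChange K).endRing) (hrel : (π : AddMonoid.End (W.baseChange K).geomPoints) * π = π - 2) {r : ℤ_[2]} (hr : r * r = r - 2)
    (hclause : ∀ τ ∈ GreenbergSelmer.inertia v, ∀ x : ↥((W.baseChange K).endEigenPrimaryTorsion 2 π r), τ • x = x ∨ τ • x = -x) :
    Nat.card (FixedPoints.addSubgroup (GreenbergSelmer.decomp vbar) ↥((W.baseChange K).endEigenPrimaryTorsion 2 π r)) = 2 := by
  have hj : W.j = -3375 := j_eq_of_smul_eq_cm7Twist hd0 W C hC
  obtain ⟨θ, hθ⟩ := exists_sq_eq_neg_seven_of_cmEndo_mem_endRing W K hj π hrel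
  exact natCard_fixedPoints_decomp_eq_two_of_exists_smul_ne W K hj hK.1 hθ π hrel hr (w := vbar) (w' := v) hvbar hv hne.symm
    (exists_mem_decomp_vbar_smul_ne_of_frame hd0 hsq hd4 hd8 W C hC hK v vbar hv hvbar hne π hrel hr hclause)

/-- **`#LK_{v̄} ≤ 2` for EVERY `ℤ₂`-line when `d ≢ 3 (mod 8)`** (layer-`0` currency of -w3's `finite_localControlKer_and_card_le_fixedPoints_decomp`, p659525:
`#LK_{v̄} ≤ #W*^{D_{v̄}} = 2`): the dyadic cokernel unit of S3c₂'s four-index identity is `v₂ ≤ 1` on these classes, unconditionally.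
[cite: Agboola2007, §3 Prop. 3.2] [cite: GreenbergLNM1716, §3 Lemma 3.3] -/
theorem natCard_localControlKer_vbar_le_two_of_frame {d : ℤ} (hd0 : d ≠ 0) (hsq : Squarefree d) (hd4 : d % 4 ≠ 1) (hd8 : d % 8 ≠ 3)
    (W : WeierstrassCurve ℚ) [W.IsElliptic] (C : VariableChange ℚ) (hC : C • W = cm7.quadraticTwist (d : ℚ)) (hK : IsImaginaryQuadratic K)
    (v vbar : HeightOneSpectrum (𝓞 K)) (hv : ((2 : ℕ) : 𝓞 K) ∈ v.asIdeal) (hvbar : ((2 : ℕ) : 𝓞 K) ∈ vbar.asIdeal) (hne : vbar ≠ v)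
    (π : (W.baseChange K).endRing) (hrel : (π : AddMonoid.End (W.baseChange K).geomPoints) * π = π - 2) {r : ℤ_[2]} (hr : r * r = r - 2)
    (hclause : ∀ τ ∈ GreenbergSelmer.inertia v, ∀ x : ↥((W.baseChange K).endEigenPrimaryTorsion 2 π r), τ • x = x ∨ τ • x = -x)
    (κ' : ZpExtension K 2) :
    Finite (resOfLe ↥((W.baseChange K).endEigenPrimaryTorsion 2 π r)
        (inf_le_inf_right (GreenbergSelmer.decomp vbar) (κ'.kerSubgroup_le_layerSubgroup 0) :
          κ'.kerSubgroup ⊓ GreenbergSelmer.decomp vbar ≤ κ'.layerSubgroup 0 ⊓ GreenbergSelmer.decomp vbar)).ker ∧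
      Nat.card (resOfLe ↥((W.baseChange K).endEigenPrimaryTorsion 2 π r)
        (inf_le_inf_right (GreenbergSelmer.decomp vbar) (κ'.kerSubgroup_le_layerSubgroup 0) :
          κ'.kerSubgroup ⊓ GreenbergSelmer.decomp vbar ≤ κ'.layerSubgroup 0 ⊓ GreenbergSelmer.decomp vbar)).ker ≤ 2 := by
  have hj : W.j = -3375 := j_eq_of_smul_eq_cm7Twist hd0 W C hC
  obtain ⟨θ, hθ⟩ := exists_sq_eq_neg_seven_of_cmEndo_mem_endRing W K hj π hrel
  have h2 := natCard_fixedPoints_decomp_vbar_eq_two_of_frame hd0 hsq hd4 hd8 W C hC hK v vbar hv hvbar hne π hrel hr hclause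
  haveI : Finite (FixedPoints.addSubgroup (GreenbergSelmer.decomp vbar) ↥((W.baseChange K).endEigenPrimaryTorsion 2 π r)) :=
    Nat.finite_of_card_ne_zero (by rw [h2]; norm_num)
  have hlev : ∀ n : ℕ, Finite (AddSubgroup.torsionBy ↥((W.baseChange K).endEigenPrimaryTorsion 2 π r) (2 ^ n : ℕ)) := by
    intro n
    haveI := (W.baseChange K).finite_torsionBy_geomPrimaryTorsion 2 n
    refine Finite.of_injective (fun b ↦ (⟨((b : ↥((W.baseChange K).endEigenPrimaryTorsion 2 π r)) :
        (W.baseChange K).geomPrimaryTorsion 2), ?_⟩ :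
        AddSubgroup.torsionBy ((W.baseChange K).geomPrimaryTorsion 2) (2 ^ n : ℕ))) ?_
    · have hb := AddSubgroup.torsionBy.nsmul_iff.mp b.2
      rw [AddSubgroup.torsionBy.nsmul_iff]
      have h1 := congrArg (fun z : ↥((W.baseChange K).endEigenPrimaryTorsion 2 π r) ↦
        (z : (W.baseChange K).geomPrimaryTorsion 2)) hb
      simpa only [AddSubmonoidClass.coe_nsmul, ZeroMemClass.coe_zero] using h1
    · intro a b hab
      apply Subtype.ext; apply Subtype.ext
      exact congrArg (fun z : AddSubgroup.torsionBy ((W.baseChange K).geomPrimaryTorsion 2) (2 ^ n : ℕ) ↦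
        (z : (W.baseChange K).geomPrimaryTorsion 2)) hab
  obtain ⟨hfin, hle⟩ := finite_localControlKer_and_card_le_fixedPoints_decomp κ'
    ↥((W.baseChange K).endEigenPrimaryTorsion 2 π r) vbar
    (continuous_smul_endEigenPrimaryTorsion (W.baseChange K) 2 π r)
    (isOpen_stabilizer_endEigenPrimaryTorsion (W.baseChange K) 2 π r)
    (exists_pow_smul_endEigenPrimaryTorsion_eq_zero (W.baseChange K) 2 π r) hlev
  exact ⟨hfin, hle.trans h2.le⟩

end Frame

end Summit.BirchSwinnertonDyer.BirchSwinnertonDyer.Theorems.PrintCf2.CMPrimes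

end
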